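import Summits.AtomisticToContinuum.Crystallization.Theses.VdwKissingSutherland
import Literature.Barriers.AtomisticToContinuum.ShortRangeStackingBlindnessHcpProofs
import Literature.MathematicalPhysics.StatisticalMechanics.MuGSC

/-!
# `SutherlandBound` (stmt-AtomisticToContinuum-3268): the hcp benchmark `L₆(hcp)` is a genuine sum

The right-hand side of the item is `N · L₆(hcp)` with
`L₆(hcp) = ∑' y : hcpStacking 1 √(2/3), ‖y‖⁻⁶` (nearest-neighbour distance `1`; the origin is a
point of the stacking and contributes `0⁻¹ ^ 6 = 0`). This file proves that the series is summable
(so the `tsum` is not a junk `0`), evaluates its first six shells from the vendored shell count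
`ConwaySloane1999_hcpShells_holds` (`12, 6, 2, 18, 12, 6` points at `1, √2, √(8/3), √3, √(11/3), 2`),
whence `L₆(hcp) ≥ 12 + 6/8 + 2(3/8)³ + 18/27 + 12(3/11)³ + 6/64 = 14167099/1022208 = 13.8593…`
(numerically `L₆(hcp) = 14.45490`), and records the elementary small-`N` case of the item: every
unit packing of `N ≤ 14` points satisfies `SutherlandBound` (each site sum has `N − 1 ≤ 13` terms
`≤ 1`). [folklore]
-/

noncomputable section

namespace Summit.AtomisticToContinuum.Crystallization.Theorems

open Literature.MathematicalPhysics.StatisticalMechanics Literature.Barriers.AtomisticToContinuum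

/-- The hcp stacking at nearest-neighbour distance `1` is uniformly discrete (separation
`min 1 √(2/3)`, `le_dist_barlowPos`). [folklore] -/
theorem uniformlyDiscrete_hcpStacking :
    UniformlyDiscrete (hcpStacking 1 (Real.sqrt (2 / 3))) := by
  refine ⟨min 1 (Real.sqrt (2 / 3)), lt_min one_pos (Real.sqrt_pos.2 (by norm_num)), ?_⟩
  rintro x ⟨k, i, j, rfl⟩ y ⟨k', i', j', rfl⟩ hne
  refine le_dist_barlowPos 1 (Real.sqrt (2 / 3)) alternatingHagg zero_le_one (Real.sqrt_nonneg _) ?_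
  intro h
  simp only [Prod.mk.injEq] at h
  obtain ⟨rfl, rfl, rfl⟩ := h
  exact hne rfl

/-- **`L₆(hcp)` is a genuine sum**: `y ↦ ‖y‖⁻⁶` is summable over `hcpStacking 1 √(2/3)`.
[folklore] -/
theorem summable_hcp_inv_norm_pow_six :
    Summable fun y : ↥(hcpStacking 1 (Real.sqrt (2 / 3))) =>
      ‖(y : EuclideanSpace ℝ (Fin 3))‖⁻¹ ^ 6 := by
  have h := uniformlyDiscrete_hcpStacking.summable_of_abs_le_inv_pow_six (V := fun t => t⁻¹ ^ 6)
    (C := 1) one_pos (fun t _ => by rw [one_mul, abs_of_nonneg (by positivity)]) 0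
  refine h.congr fun y => ?_
  rw [dist_comm, dist_zero_right]

/-- `L₆(hcp)` is non-negative. [folklore] -/
theorem hcp_inv_norm_pow_six_tsum_nonneg :
    0 ≤ ∑' y : ↥(hcpStacking 1 (Real.sqrt (2 / 3))), ‖(y : EuclideanSpace ℝ (Fin 3))‖⁻¹ ^ 6 :=
  tsum_nonneg fun _ => by positivity

/-- Finite partial sums over points of the stacking are bounded by `L₆(hcp)`. [folklore] -/
theorem sum_le_hcp_tsum (U : Finset (EuclideanSpace ℝ (Fin 3)))
    (hU : ∀ y ∈ U, y ∈ hcpStacking 1 (Real.sqrt (2 / 3))) :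
    ∑ y ∈ U, ‖y‖⁻¹ ^ 6 ≤
      ∑' y : ↥(hcpStacking 1 (Real.sqrt (2 / 3))), ‖(y : EuclideanSpace ℝ (Fin 3))‖⁻¹ ^ 6 := by
  classical
  have h1 := Finset.sum_subtype_of_mem (fun y : EuclideanSpace ℝ (Fin 3) => ‖y‖⁻¹ ^ 6)
    (p := (· ∈ hcpStacking 1 (Real.sqrt (2 / 3)))) hU
  rw [← h1]
  exact summable_hcp_inv_norm_pow_six.sum_le_tsum _ (fun y _ => by positivity)

/-- One shell: the points of the stacking at distance `r > 0` from the origin contribute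
`#shell · r⁻⁶`. [folklore] -/
theorem sum_hcp_shell_eq {r : ℝ}
    (hfin : (hcpStacking 1 (Real.sqrt (2 / 3)) ∩ Metric.sphere 0 r).Finite) :
    ∑ y ∈ hfin.toFinset, ‖y‖⁻¹ ^ 6 =
      (hcpStacking 1 (Real.sqrt (2 / 3)) ∩ Metric.sphere 0 r).ncard * r⁻¹ ^ 6 := by
  rw [Set.ncard_eq_toFinset_card _ hfin, Finset.sum_congr rfl (g := fun _ => r⁻¹ ^ 6),
    Finset.sum_const, nsmul_eq_mul]
  intro y hy
  rw [Set.Finite.mem_toFinset] at hy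
  rw [mem_sphere_zero_iff_norm.1 hy.2]

/-- Adding a shell of radius `r` to a finite set of points of norm `< r`. [folklore] -/
theorem sum_union_shell {A B : Finset (EuclideanSpace ℝ (Fin 3))} {R r : ℝ}
    (hA : ∀ y ∈ A, ‖y‖ ≤ R) (hB : ∀ y ∈ B, ‖y‖ = r) (hRr : R < r) :
    ∑ y ∈ A ∪ B, ‖y‖⁻¹ ^ 6 = ∑ y ∈ A, ‖y‖⁻¹ ^ 6 + ∑ y ∈ B, ‖y‖⁻¹ ^ 6 ∧
      ∀ y ∈ A ∪ B, ‖y‖ ≤ r := by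
  refine ⟨Finset.sum_union (Finset.disjoint_left.2 fun y hyA hyB => ?_), fun y hy => ?_⟩
  · have := hA y hyA
    rw [hB y hyB] at this
    exact absurd this (not_le.2 hRr)
  · rcases Finset.mem_union.1 hy with h | h
    · exact (hA y h).trans hRr.le
    · exact (hB y h).le

/-- `(√m)⁻¹ ^ 6 = (m³)⁻¹` for `m ≥ 0`. [folklore] -/
theorem inv_sqrt_pow_six {m : ℝ} (hm : 0 ≤ m) : (Real.sqrt m)⁻¹ ^ 6 = (m ^ 3)⁻¹ := by
  rw [inv_pow, show (6 : ℕ) = 2 * 3 from rfl, pow_mul, Real.sq_sqrt hm]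

/-- **The first six shells of `L₆(hcp)`**: with `12, 6, 2, 18, 12, 6` points at distances
`1, √2, √(8/3), √3, √(11/3), 2` from the origin (`ConwaySloane1999_hcpShells_holds`),
`12 + 6·2⁻³ + 2·(8/3)⁻³ + 18·3⁻³ + 12·(11/3)⁻³ + 6·4⁻³ = 14167099/1022208 ≤ L₆(hcp)`
(`= 13.8593…`; the full sum is `14.45490`). [folklore] -/
theorem hcp_six_shells_le_tsum :
    (14167099 / 1022208 : ℝ) ≤
      ∑' y : ↥(hcpStacking 1 (Real.sqrt (2 / 3))), ‖(y : EuclideanSpace ℝ (Fin 3))‖⁻¹ ^ 6 := by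
  classical
  set H := hcpStacking 1 (Real.sqrt (2 / 3)) with hH
  -- the origin is a point of the stacking (`barlowPos 0 0 0 = 0`; cf.
  -- `PalmUnimodularRigidity.zero_mem_hcpStacking`)
  have h0 : (0 : EuclideanSpace ℝ (Fin 3)) ∈ H := ⟨0, 0, 0, by simp [barlowPos]⟩
  obtain ⟨h1, h2, h3, h4, h5, h6, -⟩ := ConwaySloane1999_hcpShells_holds 0 h0
  -- the six shells as finsets
  have fin : ∀ {r : ℝ} {n : ℕ}, (H ∩ Metric.sphere 0 r).ncard = n → n ≠ 0 →
      (H ∩ Metric.sphere 0 r).Finite := fun h hn => Set.finite_of_ncard_ne_zero (h ▸ hn)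
  have f1 := fin h1 (by norm_num)
  have f2 := fin h2 (by norm_num)
  have f3 := fin h3 (by norm_num)
  have f4 := fin h4 (by norm_num)
  have f5 := fin h5 (by norm_num)
  have f6 := fin h6 (by norm_num)
  -- norms on each shell
  have nrm : ∀ {r : ℝ} (hf : (H ∩ Metric.sphere 0 r).Finite), ∀ y ∈ hf.toFinset, ‖y‖ = r := by
    intro r hf y hy
    rw [Set.Finite.mem_toFinset] at hy
    exact mem_sphere_zero_iff_norm.1 hy.2
  have mem : ∀ {r : ℝ} (hf : (H ∩ Metric.sphere 0 r).Finite), ∀ y ∈ hf.toFinset, y ∈ H := by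
    intro r hf y hy
    rw [Set.Finite.mem_toFinset] at hy
    exact hy.1
  -- radii are increasing
  have r12 : (1 : ℝ) < √2 := by
    rw [show (1 : ℝ) = √1 from Real.sqrt_one.symm]; exact Real.sqrt_lt_sqrt zero_le_one (by norm_num)
  have r23 : √2 < √(8 / 3) := Real.sqrt_lt_sqrt (by norm_num) (by norm_num)
  have r34 : √(8 / 3) < √3 := Real.sqrt_lt_sqrt (by norm_num) (by norm_num)
  have r45 : √3 < √(11 / 3) := Real.sqrt_lt_sqrt (by norm_num) (by norm_num)
  have r56 : √(11 / 3) < (2 : ℝ) := by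
    rw [show (2 : ℝ) = √4 by rw [show (4 : ℝ) = 2 ^ 2 by norm_num, Real.sqrt_sq zero_le_two]]
    exact Real.sqrt_lt_sqrt (by norm_num) (by norm_num)
  -- accumulate the shells
  obtain ⟨s2, b2⟩ := sum_union_shell (fun y hy => (nrm f1 y hy).le) (nrm f2) r12
  obtain ⟨s3, b3⟩ := sum_union_shell b2 (nrm f3) r23
  obtain ⟨s4, b4⟩ := sum_union_shell b3 (nrm f4) r34
  obtain ⟨s5, b5⟩ := sum_union_shell b4 (nrm f5) r45
  obtain ⟨s6, -⟩ := sum_union_shell b5 (nrm f6) r56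
  have hU : ∀ y ∈ f1.toFinset ∪ f2.toFinset ∪ f3.toFinset ∪ f4.toFinset ∪ f5.toFinset ∪ f6.toFinset,
      y ∈ H := by
    intro y hy
    simp only [Finset.mem_union] at hy
    rcases hy with ((((hy | hy) | hy) | hy) | hy) | hy
    exacts [mem f1 y hy, mem f2 y hy, mem f3 y hy, mem f4 y hy, mem f5 y hy, mem f6 y hy]
  have key := sum_le_hcp_tsum _ hU
  rw [s6, s5, s4, s3, s2, sum_hcp_shell_eq f1, sum_hcp_shell_eq f2, sum_hcp_shell_eq f3,
    sum_hcp_shell_eq f4, sum_hcp_shell_eq f5, sum_hcp_shell_eq f6, h1, h2, h3, h4, h5, h6,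
    inv_sqrt_pow_six (by norm_num), inv_sqrt_pow_six (by norm_num), inv_sqrt_pow_six (by norm_num),
    inv_sqrt_pow_six (by norm_num)] at key
  have hval : ((12 : ℕ) : ℝ) * (1 : ℝ)⁻¹ ^ 6 + ((6 : ℕ) : ℝ) * ((2 : ℝ) ^ 3)⁻¹ +
      ((2 : ℕ) : ℝ) * (((8 : ℝ) / 3) ^ 3)⁻¹ + ((18 : ℕ) : ℝ) * ((3 : ℝ) ^ 3)⁻¹ +
      ((12 : ℕ) : ℝ) * (((11 : ℝ) / 3) ^ 3)⁻¹ + ((6 : ℕ) : ℝ) * (2 : ℝ)⁻¹ ^ 6 =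
      14167099 / 1022208 := by norm_num
  linarith

/-- Numeric form: `13 < L₆(hcp)` (indeed `13.859 ≤ L₆(hcp)`). [folklore] -/
theorem thirteen_lt_hcp_tsum :
    (13 : ℝ) < ∑' y : ↥(hcpStacking 1 (Real.sqrt (2 / 3))), ‖(y : EuclideanSpace ℝ (Fin 3))‖⁻¹ ^ 6 :=
  lt_of_lt_of_le (by norm_num) hcp_six_shells_le_tsum

/-- A site sum of a unit packing of `N` points has `N − 1` off-diagonal terms, each `≤ 1`.
[folklore] -/
theorem site_sum_le_card_sub_one {N : ℕ} (x : Fin N → EuclideanSpace ℝ (Fin 3))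
    (hsep : ∀ i j, i ≠ j → 1 ≤ dist (x i) (x j)) (i : Fin N) :
    ∑ j, (dist (x i) (x j))⁻¹ ^ 6 ≤ (N : ℝ) - 1 := by
  rw [← Finset.add_sum_erase _ _ (Finset.mem_univ i), dist_self, inv_zero,
    zero_pow (by norm_num), zero_add]
  calc ∑ j ∈ Finset.univ.erase i, (dist (x i) (x j))⁻¹ ^ 6
      ≤ ∑ _j ∈ Finset.univ.erase i, (1 : ℝ) := Finset.sum_le_sum fun j hj => by
        have h1 := hsep i j (Finset.ne_of_mem_erase hj).symm
        exact pow_le_one₀ (inv_nonneg.2 dist_nonneg) (inv_le_one_of_one_le₀ h1)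
    _ = (N : ℝ) - 1 := by
        rw [Finset.sum_const, nsmul_eq_mul, mul_one, Finset.card_erase_of_mem (Finset.mem_univ i),
          Finset.card_univ, Fintype.card_fin, Nat.cast_sub, Nat.cast_one]
        exact Fin.pos i

/-- **`SutherlandBound` for packings of at most `14` points** (unconditional small-`N` case of
item stmt-AtomisticToContinuum-3268): each of the `N` site sums is `≤ N − 1 ≤ 13 < L₆(hcp)`.
[folklore] -/
theorem sutherlandBound_of_le_fourteen {N : ℕ} (hN : N ≤ 14)
    (x : Fin N → EuclideanSpace ℝ (Fin 3)) (hsep : ∀ i j, i ≠ j → 1 ≤ dist (x i) (x j)) :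
    ∑ i, ∑ j, (dist (x i) (x j))⁻¹ ^ 6 ≤
      (N : ℝ) * ∑' y : ↥(hcpStacking 1 (Real.sqrt (2 / 3))), ‖(y : EuclideanSpace ℝ (Fin 3))‖⁻¹ ^ 6 := by
  have h13 := thirteen_lt_hcp_tsum
  have hN' : (N : ℝ) - 1 ≤ 13 := by
    have : (N : ℝ) ≤ 14 := by exact_mod_cast hN
    linarith
  calc ∑ i, ∑ j, (dist (x i) (x j))⁻¹ ^ 6
      ≤ ∑ _i : Fin N, ∑' y : ↥(hcpStacking 1 (Real.sqrt (2 / 3))),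
          ‖(y : EuclideanSpace ℝ (Fin 3))‖⁻¹ ^ 6 :=
        Finset.sum_le_sum fun i _ => ((site_sum_le_card_sub_one x hsep i).trans hN').trans h13.le
    _ = (N : ℝ) * ∑' y : ↥(hcpStacking 1 (Real.sqrt (2 / 3))),
          ‖(y : EuclideanSpace ℝ (Fin 3))‖⁻¹ ^ 6 := by
        rw [Finset.sum_const, Finset.card_univ, Fintype.card_fin, nsmul_eq_mul]

end Summit.AtomisticToContinuum.Crystallization.Theorems
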